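import Summits.BirchSwinnertonDyer.BirchSwinnertonDyer.Theorems.AdditiveBranchIMCGordTwoRankOneHeegnerKolyvaginHorizontal
import HarnessLib

/-!
# Route `AdditiveBranchIMC` (rung K1), crux `GordTwoRankOne` (item 19358): the Heegner–Kolyvagin road,
# Part 17d — the WHOLE tower-surjective locus (every odd `p`, `p ∣ ∏c` allowed) on the Kolyvagin-index road:
# the crux's LOWER half from BSD-DEPTH Kolyvagin certificates `M_∞ ≤ ord_p ∏c_ℓ(E)` at the odd Manin-good
# frames, and the crux BY NAME with STEP L′ replaced by those certificates
# (cell `bsd-addord`, second prover lane `bsd-addord-k1-c3x`, gen 3; `--supports` only)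

HONEST FRAMING. THEOREMS ONLY: no definition, no new named fact, no `sorry`; nothing is booked; crux 19358
and item 20498 stay OPEN at class level; BSD is not proved by any of this. The certificate hypotheses below
(`hCertW`, `hCert`) are DISPLAYED inputs — Kolyvagin's conjecture in McCallum's quantified form — never asserted.

WHY. Parts 17b/17c serve the ♯ sub-rows (`p ≥ 5`, ♠(1), ♠(2), `p ∤ ∏c`) from the sibling route's crux
`M_∞ = 0`. Off ♯ the mod-`p` form is FALSE where `p ∣ ∏c_ℓ(E)` (Jetchev: `p ∣ c_ℓ` forces extra
divisibility of `y_K`) and the sibling road excludes `p = 3`. What BSD predicts at an ODD Manin-good frame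
(odd `d_K`, `p ∤ d_K`, `p ∤ c`: then `ord_p ∏c(E^{d_K}) = ord_p ∏c(E)`, x11b/X2) is, via Kolyvagin's structure
theorem and Gross–Zagier, `M_∞ = t_E := ord_p ∏c_ℓ(E)` — in McCallum's finite currency a certificate
`Three.Koly.CertificateAt Dt β ι p M` with `M ≤ t_E` (x11b's K0⋆ form; the tree's door
`Three.Koly.indexLowerBoundAt_of_certificateAt_of_mccallum`). This file runs Part 17b's horizontal kernel on
THAT input: §27 one pair, every odd `p`, tower-surjective, additive potentially good, `r_an = 1` —
PUB + a datum with `p ∤ c` + [a certificate of depth `≤ t_E` at the odd frames of this curve] ⟹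
`Typed.MissingLowerBoundAt W p`; class level on ALL tower-surjective rows of cell (G-ord, `e = 2`) (every odd
`p`, `p ∣ ∏c` allowed) from PUB + a Manin rider + the certificates; §28 the crux BY NAME with the SAME
displayed complement as Part 8 (`gordTwoRankOne_of_adjustedIndexBound_of_rest`: non-CM non-tower-surjective
rows) but with STEP L′ (`hL'`, item 20498) REPLACED by the certificates `hCert` + the Manin rider (discharged
at `p ≥ 11` by Edixhoven, at `p ∈ {5,7}` by the sibling's item 20136, displayed at `p = 3`). Relation: at a
frame, certificate (depth `≤ t_E`) ⟹ STEP L ⟹ STEP L′ (Part 8); the certificate is the STRONGER input but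
the one a derived-class computation (McCallum / Jetchev–Lauter–Stein) or the sibling's Kolyvagin-system road
delivers.

References: [McCallumLMS1991] §5 Lemma 5.1, Cor. 5.6; [Kolyvagin1991]; [WZhang2014] Thm. 10.2, Remark 5;
[Jetchev2008]; [GrossZagier1986] V.§2; [JetchevSkinnerWan2017] §7.4.1; [Kato2004Asterisque] Thm. 14.5 (3);
[EdixhovenManin1991] Thm. 3; [LiLiuTian2024] Thm. 1.1; [Miller2011LMS] Def. 1.1.
-/

set_option autoImplicit false
set_option linter.dupNamespace false
noncomputable section
open scoped Classical NumberField
open WeierstrassCurve NumberField IsDedekindDomain Literature.NumberTheory.EllipticCurves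
  Literature.NumberTheory.EllipticCurves.ModularForms Literature.NumberTheory.EllipticCurves.Rank1Residual
  Literature.NumberTheory.EllipticCurves.Rank1Residual.Typed Literature.NumberTheory.Automorphic
  Summit.BirchSwinnertonDyer.Rank1Residual Summit.BirchSwinnertonDyer.Rank1Residual.Additive
  Summit.BirchSwinnertonDyer.Rank1Residual.X11b Summit.BirchSwinnertonDyer.Rank1Residual.GaloisImage
  Summit.BirchSwinnertonDyer.BirchSwinnertonDyer.Theses.AdditiveKolyvaginRoad
  Summit.BirchSwinnertonDyer.BirchSwinnertonDyer.Theorems.AdditiveKolyvaginKernel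

namespace Summit.BirchSwinnertonDyer.BirchSwinnertonDyer.Theorems.AdditiveBranchIMCGordTwoRankOne.HeegnerKolyvagin

/-! ### §27 The LOWER half from BSD-depth Kolyvagin certificates (`M_∞ ≤ t_E`) — every odd `p`, tower-surjective -/

/-- **THE HORIZONTAL KERNEL FOR THE LOWER HALF on BSD-depth certificates (one pair, every ODD `p`).** `W/ℚ`
globally minimal non-CM, `p` odd ADDITIVE and potentially good, `r_an = 1`, `ρ̄_{E,p^m}` onto for all `m`;
PUBLISHED inputs `PublishedInputsAdditiveKoly` (`hPub`) and Kato 14.5 (3) at the twist (`hKatoT`); a datum with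
`p ∤ c` (`hD`); and, at the odd Manin-good frames `(K, Dt, β, ι)` of THIS curve, a Kolyvagin certificate of
depth `M ≤ t_E = ord_p ∏c_ℓ(E)` (`hCertW`: `Three.Koly.CertificateAt Dt β ι p M`, i.e. `M_∞ ≤ M` — some
`n ∈ S_r(M+1)` with `P_n ∉ p^{M+1}E(K[n])`; the value BSD predicts for `M_∞` at such a frame). CONCLUSION:
`Typed.MissingLowerBoundAt W p` (Part 17b's kernel steps, then x11b's K0⋆ door
`Three.Koly.indexLowerBoundAt_of_certificateAt_of_mccallum`, Part 8's comparison and pointwise door). `p = 3`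
and `p ∣ ∏c` allowed; no ♠. [cite: McCallumLMS1991, §5 Lemma 5.1 (p. 303) and Cor. 5.6 (p. 310)]
[cite: Kato2004Asterisque, Thm. 14.5 (3) (p. 236)] [cite: JetchevSkinnerWan2017, §7.4.1 (pp. 29–31)]
[cite: Darmon2004, Thm. 3.6] -/
theorem missingLowerBoundAt_rankOne_additive_potGood_of_certificates
    (hPub : PublishedInputsAdditiveKoly)
    (hKatoT : Kato2004.rankZero_padicValNat_sha_add_padicValNat_tamagawa_le_of_additive_potGood_of_imageContainsSL2)
    (W : WeierstrassCurve ℚ) [W.IsElliptic] [W.IsGloballyMinimal] [NeZero (W.conductorNorm ℤ)]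
    (p : ℕ) [Fact p.Prime] (hCM : ¬ W.HasCM) (hp2 : p ≠ 2) (hadd : Addv W p)
    (hj : 0 ≤ padicValRat p W.j) (hr : W.analyticRank = 1)
    (hsurj : ∀ m : ℕ, W.HasSurjectiveModNGaloisRep (p ^ m : ℕ))
    (hD : ∃ Dt : ModularParametrizationData W (W.conductorNorm ℤ), ¬ (p : ℤ) ∣ Dt.c)
    (hCertW : ∀ (K : Type) [Field K] [NumberField K]
      (Dt : ModularParametrizationData W (W.conductorNorm ℤ)) (β : ℤ) (ι : K →+* ℂ),
      IsImaginaryQuadratic K → Odd (NumberField.discr K) →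
      SatisfiesHeegnerHypothesis (W.conductorNorm ℤ) K →
      (W.quadraticTwist (NumberField.discr K : ℚ)).entireLFunction 1 ≠ 0 →
      (4 * (W.conductorNorm ℤ : ℤ)) ∣ β ^ 2 - NumberField.discr K → ¬ (p : ℤ) ∣ Dt.c →
      ∃ M : ℕ, M ≤ padicValNat p W.tamagawaProduct ∧ Three.Koly.CertificateAt Dt β ι p M) :
    Typed.MissingLowerBoundAt W p := by
  obtain ⟨hGZ, hKo, hB, hGZK, hmod, hnf, hHL, hrec, hMc, h36⟩ := hPub
  have hp : p.Prime := Fact.out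
  have hsurjp : W.HasSurjectiveModNGaloisRep p := by simpa using hsurj 1
  have hirr : Irr W p := hasIrreducibleModPGaloisRep_of_hasSurjectiveModNGaloisRep W p hsurjp
  -- the odd Hoffstein–Luo frame with `d_K < -4`, Darmon's datum, non-torsion, Kolyvagin, `E(K)[p] = 0`, `p^{M₀} ∥ y_K`
  obtain ⟨K, _, _, Dt, H, ι, P, Wd, _, _, Cd, hK, hodd, hlt, hpd, hHN, hP, hc, hμ, hLt, hWd⟩ :=
    exists_oddHeegnerFrame_lt_of_exists_not_dvd hnf hHL W p hr hp2 hD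
  have h3 : NumberField.discr K ≠ -3 := by omega
  have h4 : NumberField.discr K ≠ -4 := by omega
  obtain ⟨d₁⟩ := kolyvaginRoadThree_hKD_of_darmon36 h36 W K Dt H.β ι hK hHN H.dvd_sq_sub
  have hPd : d₁.toGeomPoints d₁.derivedPoint = toGeomPoints (W.baseChange K) P :=
    KolyvaginBottom.toGeomPoints_derivedPoint_one_eq (hrec _ W K) hK hHN hP d₁ rfl
  have hPinf : ¬ IsOfFinAddOrder P :=
    not_isOfFinAddOrder_of_heegner_of_analyticRank_eq_one W (W.conductorNorm ℤ) K Dt H ι P (hGZ _ W K)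
      hmod hr hK hHN hLt hP
  obtain ⟨hrank, hSha⟩ := hKo (W.conductorNorm ℤ) W K hK hHN ⟨Dt, H, ι, hP⟩ hPinf
  haveI : Finite (W.baseChange K).sha := hSha
  have hbot := torsionBy_eq_bot_of_isImaginaryQuadratic_of_hasIrreducibleModPGaloisRep W K hK hp hirr
  have hiv : ∀ x : (W.baseChange K).toAffine.Point, p • x = 0 → x = 0 := fun x hx ↦ by
    have hmem : x ∈ AddSubgroup.torsionBy (W.baseChange K).toAffine.Point ((p : ℕ) : ℤ) := by
      rw [mem_torsionBy_iff, natCast_zsmul]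
      exact hx
    rw [hbot] at hmem
    exact hmem
  haveI : Module.Finite ℤ (W.baseChange K).toAffine.Point := (W.baseChange K).module_finite_point_holds
  obtain ⟨M₀, x₀, hx₀, hmax⟩ := exists_pow_smul_eq_and_forall_ne hPinf (p := p) hp.two_le
  have hdiv : ∃ Q : (W.baseChange K).toAffine.Point, ((p ^ M₀ : ℕ) : ℤ) • Q = P :=
    ⟨x₀, by rw [natCast_zsmul]; exact hx₀⟩
  have hndiv : ¬ ∃ Q : (W.baseChange K).toAffine.Point, ((p ^ (M₀ + 1) : ℕ) : ℤ) • Q = P := by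
    rintro ⟨Q, hQ⟩
    exact hmax Q (by rw [← natCast_zsmul]; exact hQ)
  -- the certificate of depth `M ≤ t_E` at this frame; x11b's K0⋆ door ⟹ STEP L ⟹ STEP L′ (Part 8)
  obtain ⟨M, hMt, hcert⟩ := hCertW K Dt H.β ι hK hodd hHN hLt H.dvd_sq_sub hc
  have hL : IndexLowerBoundAt W p K P :=
    Three.Koly.indexLowerBoundAt_of_certificateAt_of_mccallum W K hMc hCM hK h3 h4 hHN p hp2 hsurj Dt H.β ι d₁
      P hPd hPinf hrank hiv hdiv hndiv hcert hMt
  have hL' := adjustedIndexBound_of_indexLowerBoundAt W p K hK hHN Dt P Cd hWd hL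
  exact missingLowerBoundAt_rankOne_additive_of_adjustedIndexBound W p K Dt H ι P (hGZ _ W K) (hKo _ W K)
    hKatoT hGZK hmod hr hp2 hadd hj hsurj hK hHN hP hμ hLt Wd Cd hWd (fun _ ↦ hL')

/-- **CLASS LEVEL, ALL tower-surjective rows of cell (G-ord, `e = 2`) ∩ `r_an = 1`, EVERY ODD `p`** (`p = 3` and
`p ∣ ∏c` included): `Typed.MissingLowerBoundAt W p` from PUB (`hPub`, `hKatoT`), a MANIN RIDER (`hMan`: a datum
with `p ∤ c` at every such row — a theorem at `p ≥ 11` (Edixhoven, gen 0 Part 2), the sibling's item 20136 at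
`p ∈ {5,7}`, Cremona's tables per optimal curve at `p = 3`; displayed here) and BSD-DEPTH CERTIFICATES
(`hCert`: at every odd Manin-good frame of every such row a Kolyvagin certificate of depth `≤ ord_p ∏c_ℓ(E)`;
displayed — Kolyvagin's conjecture in McCallum's quantified form, the value BSD predicts). Non-CM is
automatic (`ρ̄_{E,p}` onto at odd `p`). Compare Part 8's class theorem (input STEP L′ at every datum).
[cite: McCallumLMS1991, §5 Cor. 5.6 (p. 310)] [cite: Kato2004Asterisque, Thm. 14.5 (3) (p. 236)]
[cite: Zywina2015, Prop. 1.14] [cite: Miller2011LMS, Def. 1.1] -/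
theorem cellGordTwo_missingLowerBoundAt_rankOne_towerSurj_of_certificates
    (hPub : PublishedInputsAdditiveKoly)
    (hKatoT : Kato2004.rankZero_padicValNat_sha_add_padicValNat_tamagawa_le_of_additive_potGood_of_imageContainsSL2)
    (hMan : ∀ (W : WeierstrassCurve ℚ) [W.IsElliptic] [W.IsGloballyMinimal] (p : ℕ) [Fact p.Prime]
      [NeZero (W.conductorNorm ℤ)], W.analyticRank = 1 → N10.CellGordTwo W p →
      (∀ m : ℕ, W.HasSurjectiveModNGaloisRep (p ^ m : ℕ)) →
      ∃ Dt : ModularParametrizationData W (W.conductorNorm ℤ), ¬ (p : ℤ) ∣ Dt.c)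
    (hCert : ∀ (W : WeierstrassCurve ℚ) [W.IsElliptic] [W.IsGloballyMinimal] (p : ℕ) [Fact p.Prime]
      [NeZero (W.conductorNorm ℤ)] (K : Type) [Field K] [NumberField K]
      (Dt : ModularParametrizationData W (W.conductorNorm ℤ)) (β : ℤ) (ι : K →+* ℂ),
      W.analyticRank = 1 → N10.CellGordTwo W p → (∀ m : ℕ, W.HasSurjectiveModNGaloisRep (p ^ m : ℕ)) →
      IsImaginaryQuadratic K → Odd (NumberField.discr K) →
      SatisfiesHeegnerHypothesis (W.conductorNorm ℤ) K →
      (W.quadraticTwist (NumberField.discr K : ℚ)).entireLFunction 1 ≠ 0 →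
      (4 * (W.conductorNorm ℤ : ℤ)) ∣ β ^ 2 - NumberField.discr K → ¬ (p : ℤ) ∣ Dt.c →
      ∃ M : ℕ, M ≤ padicValNat p W.tamagawaProduct ∧ Three.Koly.CertificateAt Dt β ι p M) :
    ∀ (W : WeierstrassCurve ℚ) [W.IsElliptic] [W.IsGloballyMinimal] (p : ℕ) [Fact p.Prime],
      W.analyticRank = 1 → N10.CellGordTwo W p →
      (∀ m : ℕ, W.HasSurjectiveModNGaloisRep (p ^ m : ℕ)) → Typed.MissingLowerBoundAt W p := by
  intro W _ _ p _ hr hc2 hsurj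
  haveI : NeZero (W.conductorNorm ℤ) := ⟨(W.conductorNorm_pos_holds).ne'⟩
  have hp : p.Prime := Fact.out
  obtain ⟨hp2, hadd, hG⟩ : p ≠ 2 ∧ Addv W p ∧ TypeGOrd W p := ⟨hc2.1, hc2.2.1, hc2.2.2.1⟩
  have hsurjp : W.HasSurjectiveModNGaloisRep p := by simpa using hsurj 1
  have hCM : ¬ W.HasCM := fun hcm ↦ not_hasSurjectiveModNGaloisRep_of_hasCM W hcm hp hp2 hsurjp
  have hj : 0 ≤ padicValRat p W.j := not_lt.mp (N10.not_potMult_of_typeGOrd W p hp2 hadd hG)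
  exact missingLowerBoundAt_rankOne_additive_potGood_of_certificates hPub hKatoT W p hCM hp2 hadd hj hr hsurj
    (hMan W p hr hc2 hsurj) (fun K _ _ Dt β ι hK hodd hHN hLt hβ hc ↦
      hCert W p K Dt β ι hr hc2 hsurj hK hodd hHN hLt hβ hc)

/-! ### §28 The crux BY NAME with STEP L′ replaced by BSD-depth certificates -/

/-- **Crux `GordTwoRankOne` (item 19358) BY NAME on the Kolyvagin-index road, WHOLE tower-surjective locus.**
Part 8's `gordTwoRankOne_of_adjustedIndexBound_of_rest` with its typed input `hL'` (STEP L′ = item 20498 at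
every datum) REPLACED by BSD-depth Kolyvagin certificates at the odd Manin-good frames (`hCert`) plus the
Manin rider (`hMan`); PUBLISHED binders `hPub` (the sibling route's conjunction), `hKatoT`, `hLLT` (CM rows,
lane A); DISPLAYED complement `hRest` = the non-CM NON-tower-surjective rows (X3♯ / O8) — the SAME
complement as Part 8. Nothing booked; 19358 stays OPEN. [cite: McCallumLMS1991, §5 Cor. 5.6 (p. 310)]
[cite: Kato2004Asterisque, Thm. 14.5 (3) (p. 236)] [cite: LiLiuTian2024, Thm. 1.1 (i)] [cite: Miller2011LMS, Def. 1.1] -/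
theorem gordTwoRankOne_of_certificates_of_rest
    (hPub : PublishedInputsAdditiveKoly)
    (hKatoT : Kato2004.rankZero_padicValNat_sha_add_padicValNat_tamagawa_le_of_additive_potGood_of_imageContainsSL2)
    (hLLT : LiLiuTian2024.thm11_bsdp_of_cm_rank_one)
    (hMan : ∀ (W : WeierstrassCurve ℚ) [W.IsElliptic] [W.IsGloballyMinimal] (p : ℕ) [Fact p.Prime]
      [NeZero (W.conductorNorm ℤ)], W.analyticRank = 1 → N10.CellGordTwo W p →
      (∀ m : ℕ, W.HasSurjectiveModNGaloisRep (p ^ m : ℕ)) →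
      ∃ Dt : ModularParametrizationData W (W.conductorNorm ℤ), ¬ (p : ℤ) ∣ Dt.c)
    (hCert : ∀ (W : WeierstrassCurve ℚ) [W.IsElliptic] [W.IsGloballyMinimal] (p : ℕ) [Fact p.Prime]
      [NeZero (W.conductorNorm ℤ)] (K : Type) [Field K] [NumberField K]
      (Dt : ModularParametrizationData W (W.conductorNorm ℤ)) (β : ℤ) (ι : K →+* ℂ),
      W.analyticRank = 1 → N10.CellGordTwo W p → (∀ m : ℕ, W.HasSurjectiveModNGaloisRep (p ^ m : ℕ)) →
      IsImaginaryQuadratic K → Odd (NumberField.discr K) →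
      SatisfiesHeegnerHypothesis (W.conductorNorm ℤ) K →
      (W.quadraticTwist (NumberField.discr K : ℚ)).entireLFunction 1 ≠ 0 →
      (4 * (W.conductorNorm ℤ : ℤ)) ∣ β ^ 2 - NumberField.discr K → ¬ (p : ℤ) ∣ Dt.c →
      ∃ M : ℕ, M ≤ padicValNat p W.tamagawaProduct ∧ Three.Koly.CertificateAt Dt β ι p M)
    (hRest : ∀ (W : WeierstrassCurve ℚ) [W.IsElliptic] [W.IsGloballyMinimal] (p : ℕ) [Fact p.Prime],
      W.analyticRank = 1 → N10.CellGordTwo W p → ¬ W.HasCM →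
      ¬ (∀ n : ℕ, W.HasSurjectiveModNGaloisRep (p ^ n : ℕ)) → Typed.MissingLowerBoundAt W p) :
    Summit.BirchSwinnertonDyer.BirchSwinnertonDyer.Theses.AdditiveBranchIMC.GordTwoRankOne := by
  intro W _ _ p _ hr hc2
  by_cases hcm : W.HasCM
  · exact gordTwoRankOne_cm_of_liLiuTian hLLT W p hr hc2 hcm
  by_cases hsurj : ∀ n : ℕ, W.HasSurjectiveModNGaloisRep (p ^ n : ℕ)
  · exact cellGordTwo_missingLowerBoundAt_rankOne_towerSurj_of_certificates hPub hKatoT hMan hCert W p hr hc2 hsurj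
  · exact hRest W p hr hc2 hcm hsurj

/-- **The Manin rider discharged where print allows**: at `p ≥ 11` by Edixhoven 1991 Thm. 3 on Kodaira
`I₀*` (gen 0 Part 2 `exists_modularParametrizationData_not_dvd_of_cellGordTwo`, PUB binders `hmodP`, `hEdxK`,
`hNS`), at `p ∈ {5, 7}` by the sibling's Manin-good-frame item 20136 (`hM`); the rider stays DISPLAYED at
`p = 3` only (`hMan3`). So the crux BY NAME reads: CM (LLT) + tower-surjective rows (BSD-depth certificates
`hCert` + item 20136 at `p ∈ {5,7}` + the `p = 3` Manin rider) + non-tower-surjective rows displayed.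
[cite: EdixhovenManin1991, Thm. 3] [cite: McCallumLMS1991, §5 Cor. 5.6 (p. 310)]
[cite: Kato2004Asterisque, Thm. 14.5 (3) (p. 236)] [cite: LiLiuTian2024, Thm. 1.1 (i)] [cite: Miller2011LMS, Def. 1.1] -/
theorem gordTwoRankOne_of_certificates_of_maninThree_of_rest
    (hPub : PublishedInputsAdditiveKoly) (hM : ManinGoodOddFrameAdditive)
    (hKatoT : Kato2004.rankZero_padicValNat_sha_add_padicValNat_tamagawa_le_of_additive_potGood_of_imageContainsSL2)
    (hmodP : nonempty_modularParametrizationData)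
    (hEdxK : edixhoven_not_dvd_maninConstant_of_kodairaSymbol_ne)
    (hNS : integral_neronScaling_of_isGloballyMinimal)
    (hLLT : LiLiuTian2024.thm11_bsdp_of_cm_rank_one)
    (hMan3 : ∀ (W : WeierstrassCurve ℚ) [W.IsElliptic] [W.IsGloballyMinimal] [Fact (Nat.Prime 3)]
      [NeZero (W.conductorNorm ℤ)], W.analyticRank = 1 → N10.CellGordTwo W 3 →
      (∀ m : ℕ, W.HasSurjectiveModNGaloisRep (3 ^ m : ℕ)) →
      ∃ Dt : ModularParametrizationData W (W.conductorNorm ℤ), ¬ (3 : ℤ) ∣ Dt.c)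
    (hCert : ∀ (W : WeierstrassCurve ℚ) [W.IsElliptic] [W.IsGloballyMinimal] (p : ℕ) [Fact p.Prime]
      [NeZero (W.conductorNorm ℤ)] (K : Type) [Field K] [NumberField K]
      (Dt : ModularParametrizationData W (W.conductorNorm ℤ)) (β : ℤ) (ι : K →+* ℂ),
      W.analyticRank = 1 → N10.CellGordTwo W p → (∀ m : ℕ, W.HasSurjectiveModNGaloisRep (p ^ m : ℕ)) →
      IsImaginaryQuadratic K → Odd (NumberField.discr K) →
      SatisfiesHeegnerHypothesis (W.conductorNorm ℤ) K →
      (W.quadraticTwist (NumberField.discr K : ℚ)).entireLFunction 1 ≠ 0 →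
      (4 * (W.conductorNorm ℤ : ℤ)) ∣ β ^ 2 - NumberField.discr K → ¬ (p : ℤ) ∣ Dt.c →
      ∃ M : ℕ, M ≤ padicValNat p W.tamagawaProduct ∧ Three.Koly.CertificateAt Dt β ι p M)
    (hRest : ∀ (W : WeierstrassCurve ℚ) [W.IsElliptic] [W.IsGloballyMinimal] (p : ℕ) [Fact p.Prime],
      W.analyticRank = 1 → N10.CellGordTwo W p → ¬ W.HasCM →
      ¬ (∀ n : ℕ, W.HasSurjectiveModNGaloisRep (p ^ n : ℕ)) → Typed.MissingLowerBoundAt W p) :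
    Summit.BirchSwinnertonDyer.BirchSwinnertonDyer.Theses.AdditiveBranchIMC.GordTwoRankOne := by
  refine gordTwoRankOne_of_certificates_of_rest hPub hKatoT hLLT ?_ hCert hRest
  intro W _ _ p _ _ hr hc2 hsurj
  have hp : p.Prime := Fact.out
  obtain ⟨hp2, hadd, hG⟩ : p ≠ 2 ∧ Addv W p ∧ TypeGOrd W p := ⟨hc2.1, hc2.2.1, hc2.2.2.1⟩
  have hsurjp : W.HasSurjectiveModNGaloisRep p := by simpa using hsurj 1
  have hirr : Irr W p := hasIrreducibleModPGaloisRep_of_hasSurjectiveModNGaloisRep W p hsurjp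
  by_cases hp7 : 7 < p
  · exact exists_modularParametrizationData_not_dvd_of_cellGordTwo hPub.2.2.2.2.2.1 hmodP hEdxK hNS W p hc2 hp7 hirr
  by_cases hp3 : p = 3
  · subst hp3
    exact hMan3 W hr hc2 hsurj
  · have hp5 : 5 ≤ p := hp.five_le_of_ne_two_of_ne_three hp2 hp3
    obtain ⟨K₀, _, _, Dt₀, -, -, -, -, -, -, -, -, -, -, -, -, hc₀, -, -, -⟩ := hM hPub W p hp5 hadd hirr hr
    exact ⟨Dt₀, hc₀⟩

end Summit.BirchSwinnertonDyer.BirchSwinnertonDyer.Theorems.AdditiveBranchIMCGordTwoRankOne.HeegnerKolyvagin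

end
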